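import Literature.MathematicalPhysics.QuantumFieldTheory.Balaban1983to89.Beta.LongitudinalSymbol
import Literature.MathematicalPhysics.QuantumFieldTheory.Balaban1983to89.Beta.WoodburyCovariant

/-!
# The continuum symbol of the BOND-BLOCK Woodbury kernel `R⊥_{u·v_μ}` and its infinite-volume limit `T ↗ ℤ^d`

HONEST SCOPE (page 1 of everything in this cell): discharging `BetaPertH` makes Bałaban's UV stability UNCONDITIONAL —
a real constructive-QFT result; it is NOT the continuum limit and NOT the Clay problem. This file is volume
BOOKKEEPING for one finite-volume certificate (`Beta/WoodburyCovariant`, the bond instance `w = u·v_μ` of §10 there);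
it claims nothing about the summit.

THE OBJECT. `Beta/WoodburyCovariant` proves, on every discrete torus, the Woodbury decomposition of the scalar
one-component `U = 1` bond covariance `(−Δ₁ + m² + aN^d (bondAvg μ)ᵀ(bondAvg μ))⁻¹` with the punctured Woodbury kernel
`R⊥_w = |𝕋|⁻¹ Σ_{q ≠ 0} κ_w(q) A^w_q(x) conj A^w_q(x′)` of the alias weight `w = u · v_μ` (`wt_bondAvg_pOf`; `u`, `v_μ` =
Bałaban's (1.31) p.23 / (1.61) p.28, typed as `B5Prop11Fiber.uSym` / `vSym`), and its volume-uniform window bounds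
(`norm_RperpW_le`, `norm_dRperpW_le`, `norm_dRperpW'_le`, `norm_ddRperpW_le`, `d = 4`). What it does not do is the
`T^{(j+1)} ↗ ℤ^d` step of [Balaban1987RG1] p.264 («Now we take a limit of these functions …»): the entrywise
infinite-volume limit of `R⊥_w`. This file performs that step, by the pattern of `Beta/WoodburySymbol` (the site weight
`u`) with the weight symbol `u_k(θ)` replaced by `w^μ_k(θ) = u_k(θ)·v_{μ,k}(θ)`.

WHAT IS PROVED (block side `n ≥ 1`, `a > 0`, `m² ≥ 0`; every statement kernel-checked, no hypotheses beyond these):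
* §0 the volume-independent continuum symbol `F^μ(θ; x, x′) = κ^μ(θ)·A^μ(θ;x)·conj A^μ(θ;x′)` of a REAL coarse momentum
  `θ ∈ ℝ^d` (`wc`, `AcB`, `ScB`, `kcB`, `FcB`), built from the tree's `uSym`, `vSym` and `WoodburySymbol.sig/phc`;
* §1 **`RperpW_eq_sum_FcB`**: on EVERY torus `R⊥_{u·v_μ}(x,x′) = |𝕋|⁻¹ Σ_{q ≠ 0} F^μ(sOf q; val x, val x′)`
  (`wt_bondAvg_eq_wc`, `fampW_eq_AcB`, `SfibW_eq_ScB`, `kapW_eq_kcB`, `fibreTermW_eq_FcB`);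
* §2 **`FcB_periodic`**: `2π`-periodicity in `θ` (the shift rotates the alias index: `WoodburySymbol.kshift`,
  `LongitudinalSymbol.uSym_shift/vSym_shift`);
* §3 continuity on the non-resonant set `nonRes = ℝ^d ∖ (2πℤ)^d` (`continuousOn_FcB`; `LongitudinalSymbol.continuous_uSym`,
  `continuous_vSym` — `v_μ` is a geometric mean, no removable singularity);
* §4 **`norm_FcB_le_of_mem_brillouin`** (`d ≥ 1`): `‖F^μ(θ)‖ ≤ C₀ᵇ + (π²/4)/ε(θ)` on the punctured zone, with
  `C₀ᵇ = 2·aliasC(d)²·(π²/4)^{d+1}·(dπ² + m²)` — BY DENSITY from `WoodburyCovariant.fibre_termW_le` at the rational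
  approximants (no continuum redo of the alias estimates);
* §5 **`RperpW_cubic_eq`** (`N^d R⊥_w = m^{-d} Σ_{k ≠ 0} F^μ(2πk/m)` on the cubic torus of coarse period `m`) and
  **`RperpW_tendsto_infiniteVolume`** (`d ≥ 3`, singular class `PuncturedRiemannSum.momentumAverage_singular_approx`):
  `N^d R⊥_w(x̂, x̂′) → (2π)^{-d}∫_{[-π,π]^d} F^μ(θ; x, x′)dθ` along the even cubic tori;
* §6 the limit kernel `RperpBLim = N^{-d}(2π)^{-d}∫F^μ` on `ℕ^d × ℕ^d`, its literal lattice differences, the convergences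
  `RperpW → RperpBLim`, `∇R⊥_w → ∇R⊥_{w,∞}`, `∇′`, `∇∇′` (`d ≥ 3`), Hermitian symmetry `RperpBLim_swap`, and for `d = 4`
  the transfer of ALL FOUR volume-uniform bounds of `WoodburyCovariant`: `‖R⊥_{w,∞}‖ ≤ Dᶜ/N⁴`, `‖∇‖, ‖∇′‖ ≤ D₁ᶜ/N⁵`,
  `‖∇∇′‖ ≤ D₂ᶜ/N⁶` (`norm_RperpBLim_le`, `norm_dRperpBLim_le`, `norm_dRperpBLim'_le`, `norm_ddRperpBLim_le`).

MEANING for the cell (GAPS G-an5g8-2): together with `FreeLegDictionary` (free leg), `WoodburySymbol` (site weight) and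
`LongitudinalSymbol` (line 3), the bond-block Woodbury part of the one-step fluctuation covariance at `U = 1` now also
HAS a certified entrywise infinite-volume limit along the cubic tori carrying its window bounds.

HONEST LIMITS: bond instance `w = u·v_μ` at `U = 1` only (a general `Admissible` weight has no volume-independent symbol
unless it is given by one); limit kernels on `ℕ^d` points only, no convergence rate, no translation covariance stated;
nothing about `U ≠ 1`, the far region, `β`, or any continuum statement.

Citations: [Balaban1984PropagatorsI] = CMP 95 (1984) 17–40, (1.18) p.20 (the bond-block average — DEFINITION/CONTEXT, via
the tree's `WoodburyCovariant.bondAvg`), (1.31) p.23 and (1.61) p.28 (`u`, `v_μ` — via the tree defs `uSym`, `vSym`);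
[King1986] = CMP 102 (1986) 649–677, (4.5) p.670 (the alias sum, context for `ScB`); [Balaban1987RG1] = CMP 109 (1987)
249–301, p.264 (the `T ↗ ℤ^d` step, located and performed here). Everything else is [folklore] and kernel-proved.
Unit `b2b-balaban-beta-an5-g8` (DEDICATED β sub-cell row BETA-an5 gen 8), node BETA-an5-g8-BOND-SYMBOL.
-/

noncomputable section

open Finset Real MeasureTheory Filter Topology
open scoped BigOperators ComplexConjugate

namespace Literature.MathematicalPhysics.QuantumFieldTheory.Balaban1983to89.Beta.WoodburyBondSymbol

open Literature.MathematicalPhysics.QuantumFieldTheory.King1986.Torus (fib z lapSym sum_fib_eq_sum_pOf)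
open Literature.MathematicalPhysics.QuantumFieldTheory.Balaban1983to89.B5Prop11Plancherel (Tor fine chi sOf abs_sOf_le
  unitVec)
open Literature.MathematicalPhysics.QuantumFieldTheory.Balaban1983to89.B4Strip (DeltaXir)
open Literature.MathematicalPhysics.QuantumFieldTheory.Balaban1983to89.B5Block118 (pOf om)
open Literature.MathematicalPhysics.QuantumFieldTheory.Balaban1983to89.B5Prop11Fiber (uSym vSym norm_uSym_le_one
  norm_vSym_le_one)
open Literature.MathematicalPhysics.QuantumFieldTheory.Balaban1983to89.Beta.WoodburyFibre (aliasC aliasC_nonneg lapSym_z)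
open Literature.MathematicalPhysics.QuantumFieldTheory.Balaban1983to89.Beta.WoodburyCovariant (wt bondAvg fampW SfibW kapW
  RperpW dRperpW dRperpW' ddRperpW wt_bondAvg_pOf u_pOf_eq_uSym fibre_termW_le admissible_bondAvg woodburyDc woodburyD1c
  woodburyD2c norm_RperpW_le norm_dRperpW_le norm_dRperpW'_le norm_ddRperpW_le RperpW_swap)
open Literature.MathematicalPhysics.QuantumFieldTheory.Balaban1983to89.Beta.FreeLegDictionary (cubic card_tor_fine_cubic)
open Literature.MathematicalPhysics.QuantumFieldTheory.Balaban1983to89.Beta.WoodburySymbol (sig phc kshift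
  kshift_injective om_shift sig_shift phc_shift sig_pos nonRes isOpen_nonRes brillouin_diff_subset_nonRes continuous_om
  continuous_phc continuous_sig vApprox thApprox tendsto_thApprox sOf_vApprox vApprox_class_ne_zero val_natCast_fine
  sOf_cubic_congr chi_pOf_eq_phc lapSym_pOf_eq_sig dispersion_le_DeltaXir emb bump emb_bump norm_le_of_near exists_even_ge)
open Literature.MathematicalPhysics.QuantumFieldTheory.Balaban1983to89.Beta.LongitudinalSymbol (uSym_shift vSym_shift
  continuous_uSym continuous_vSym)
open Literature.Probability.LatticeModels (brillouin dispersion TorusSite latticeMomentum continuous_dispersion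
  dispersion_add_int_mul)
open Literature.MathematicalPhysics.QuantumFieldTheory.Balaban1983to89.Beta.PuncturedRiemannSum
  (momentumAverage_singular_approx)

variable {d : ℕ} (n : ℕ) [NeZero n]

/-! ## §0 The continuum fibre functions of the bond weight `w = u · v_μ` -/

/-- THE CONTINUUM BOND WEIGHT at alias `k`: `w^μ_k(θ) = u_k(θ) · v_{μ,k}(θ)` (Bałaban's `u = Π_ν v_ν` of (1.31) and
`v_μ = ∂¹_μ/∂_μ` of (1.61), typed as `B5Prop11Fiber.uSym`, `vSym`). [folklore] -/
def wc (k : Fin d → Fin n) (θ : Fin d → ℝ) (μ : Fin d) : ℂ := uSym n k θ * vSym n k θ μ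

/-- THE CONTINUUM BOND FIBRE AMPLITUDE `A^μ(θ; x) = Σ_k conj(e^{i(θ+2πk)·x/n}) w^μ_k(θ)/σ_k(θ)`. [folklore] -/
def AcB (m2 : ℝ) (μ : Fin d) (x : Fin d → ℕ) (θ : Fin d → ℝ) : ℂ :=
  ∑ k : Fin d → Fin n, conj (phc n k θ x) * (wc n k θ μ / (sig n m2 k θ : ℂ))

/-- THE CONTINUUM BOND ALIAS SUM `S^μ(θ) = Σ_k |w^μ_k(θ)|²/σ_k(θ)` (King's (4.5) with `u → u·v_μ`).
[cite: King1986, (4.5) p.670] -/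
def ScB (m2 : ℝ) (μ : Fin d) (θ : Fin d → ℝ) : ℝ := ∑ k : Fin d → Fin n, ‖wc n k θ μ‖ ^ 2 / sig n m2 k θ

/-- THE CONTINUUM SHERMAN–MORRISON COEFFICIENT `κ^μ(θ) = a/(1 + aS^μ(θ))`. [folklore] -/
def kcB (a m2 : ℝ) (μ : Fin d) (θ : Fin d → ℝ) : ℝ := a / (1 + a * ScB n m2 μ θ)

/-- THE CONTINUUM BOND WOODBURY SYMBOL `F^μ(θ; x, x′) = κ^μ(θ)·A^μ(θ;x)·conj A^μ(θ;x′)`. [folklore] -/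
def FcB (a m2 : ℝ) (μ : Fin d) (x x' : Fin d → ℕ) (θ : Fin d → ℝ) : ℂ :=
  (kcB n a m2 μ θ : ℂ) * AcB n m2 μ x θ * conj (AcB n m2 μ x' θ)

/-! ## §1 Identification: on every torus the bond Woodbury kernel is a punctured coarse-momentum sum of `F^μ` -/

section Ident

variable (M : Fin d → ℕ) [hM : ∀ μ, NeZero (M μ)]

/-- the alias weight of the bond average at `p′ + 2πk` IS `w^μ_k(p′)`. [folklore] -/
theorem wt_bondAvg_eq_wc (μ : Fin d) (k : Fin d → Fin n) (q : Tor M) :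
    wt n M (bondAvg n M μ) (pOf n M (k, q)) = wc n k (sOf M q) μ := by
  rw [wc, wt_bondAvg_pOf, u_pOf_eq_uSym]

/-- `A^w_q(x) = A^μ(p′(q); x)`. [folklore] -/
theorem fampW_eq_AcB (m2 : ℝ) (μ : Fin d) (q : Tor M) (x : Tor (fine n M)) :
    fampW n M (wt n M (bondAvg n M μ)) m2 q x = AcB n m2 μ (fun ν => (x ν).val) (sOf M q) := by
  unfold fampW AcB
  rw [sum_fib_eq_sum_pOf]
  refine Finset.sum_congr rfl fun k _ => ?_
  rw [chi_pOf_eq_phc, wt_bondAvg_eq_wc, lapSym_pOf_eq_sig]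

/-- `S_w(q) = S^μ(p′(q))`. [folklore] -/
theorem SfibW_eq_ScB (m2 : ℝ) (μ : Fin d) (q : Tor M) :
    SfibW n M (wt n M (bondAvg n M μ)) ((n : ℝ) ^ 2) m2 q = ScB n m2 μ (sOf M q) := by
  unfold SfibW ScB
  rw [sum_fib_eq_sum_pOf]
  refine Finset.sum_congr rfl fun k _ => ?_
  rw [wt_bondAvg_eq_wc, lapSym_pOf_eq_sig]

/-- `κ_w(q) = κ^μ(p′(q))`. [folklore] -/
theorem kapW_eq_kcB (a m2 : ℝ) (μ : Fin d) (q : Tor M) :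
    kapW n M (wt n M (bondAvg n M μ)) a ((n : ℝ) ^ 2) m2 q = kcB n a m2 μ (sOf M q) := by
  unfold kapW kcB
  rw [SfibW_eq_ScB]

/-- THE FIBRE TERM IS THE SYMBOL: `κ_w(q) A^w_q(x) conj A^w_q(x′) = F^μ(p′(q); x, x′)`. [folklore] -/
theorem fibreTermW_eq_FcB (a m2 : ℝ) (μ : Fin d) (q : Tor M) (x x' : Tor (fine n M)) :
    (kapW n M (wt n M (bondAvg n M μ)) a ((n : ℝ) ^ 2) m2 q : ℂ) * fampW n M (wt n M (bondAvg n M μ)) m2 q x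
        * conj (fampW n M (wt n M (bondAvg n M μ)) m2 q x')
      = FcB n a m2 μ (fun ν => (x ν).val) (fun ν => (x' ν).val) (sOf M q) := by
  rw [FcB, kapW_eq_kcB, fampW_eq_AcB, fampW_eq_AcB]

/-- **`R⊥_{u·v_μ}` IS A PUNCTURED COARSE-MOMENTUM SUM OF THE SYMBOL**:
`R⊥_w(x,x′) = |𝕋|⁻¹ Σ_{q ≠ 0} F^μ(p′(q); x, x′)`. [folklore] -/
theorem RperpW_eq_sum_FcB (a m2 : ℝ) (μ : Fin d) (x x' : Tor (fine n M)) :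
    RperpW n M (wt n M (bondAvg n M μ)) a m2 x x' = ((Fintype.card (Tor (fine n M)) : ℂ))⁻¹ *
      ∑ q ∈ (univ : Finset (Tor M)).erase 0,
        FcB n a m2 μ (fun ν => (x ν).val) (fun ν => (x' ν).val) (sOf M q) := by
  unfold RperpW
  congr 1
  exact Finset.sum_congr rfl fun q _ => fibreTermW_eq_FcB n M a m2 μ q x x'

end Ident

/-! ## §2 `2π`-periodicity: an integer shift of `θ` permutes the alias index `k` cyclically -/

/-- `w^μ` is invariant: `w^μ(k, θ + 2πz) = w^μ((k+z) mod n, θ)`. [folklore] -/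
theorem wc_shift (z : Fin d → ℤ) (k : Fin d → Fin n) (θ : Fin d → ℝ) (μ : Fin d) :
    wc n k (fun ν => θ ν + 2 * π * (z ν : ℝ)) μ = wc n (kshift n z k) θ μ := by
  unfold wc
  rw [uSym_shift, vSym_shift]

/-- **`A^μ(θ; x)` is `2π`-periodic in every coordinate of `θ`** (integer `x`). [folklore] -/
theorem AcB_periodic (m2 : ℝ) (μ : Fin d) (x : Fin d → ℕ) (θ : Fin d → ℝ) (z : Fin d → ℤ) :
    AcB n m2 μ x (fun ν => θ ν + 2 * π * (z ν : ℝ)) = AcB n m2 μ x θ := by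
  unfold AcB
  simp_rw [phc_shift, wc_shift, sig_shift]
  exact Fintype.sum_bijective (kshift n z) ((Finite.injective_iff_bijective).mp (kshift_injective n z)) _ _
    fun k => rfl

/-- `S^μ(θ)` is `2π`-periodic. [folklore] -/
theorem ScB_periodic (m2 : ℝ) (μ : Fin d) (θ : Fin d → ℝ) (z : Fin d → ℤ) :
    ScB n m2 μ (fun ν => θ ν + 2 * π * (z ν : ℝ)) = ScB n m2 μ θ := by
  unfold ScB
  simp_rw [wc_shift, sig_shift]
  exact Fintype.sum_bijective (kshift n z) ((Finite.injective_iff_bijective).mp (kshift_injective n z)) _ _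
    fun k => rfl

/-- `κ^μ(θ)` is `2π`-periodic. [folklore] -/
theorem kcB_periodic (a m2 : ℝ) (μ : Fin d) (θ : Fin d → ℝ) (z : Fin d → ℤ) :
    kcB n a m2 μ (fun ν => θ ν + 2 * π * (z ν : ℝ)) = kcB n a m2 μ θ := by
  unfold kcB
  rw [ScB_periodic]

/-- **THE SYMBOL `F^μ(θ; x, x′)` IS `2π`-PERIODIC** in every coordinate of `θ`. [folklore] -/
theorem FcB_periodic (a m2 : ℝ) (μ : Fin d) (x x' : Fin d → ℕ) (θ : Fin d → ℝ) (z : Fin d → ℤ) :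
    FcB n a m2 μ x x' (fun ν => θ ν + 2 * π * (z ν : ℝ)) = FcB n a m2 μ x x' θ := by
  unfold FcB
  rw [kcB_periodic, AcB_periodic, AcB_periodic]

/-! ## §3 Continuity of `F^μ` on the non-resonant set `ℝ^d ∖ (2πℤ)^d` -/

/-- continuity of `w^μ_k` (a product of geometric means of unimodular phases). [folklore] -/
theorem continuous_wc (k : Fin d → Fin n) (μ : Fin d) : Continuous fun θ : Fin d → ℝ => wc n k θ μ := by
  unfold wc
  exact (continuous_uSym n k).mul (continuous_vSym n k μ)

omit [NeZero n] in
/-- `|w^μ_k| ≤ 1` (`|u| ≤ 1`, `|v_μ| ≤ 1`). [folklore] -/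
theorem norm_wc_le_one (hn : 1 ≤ n) (k : Fin d → Fin n) (θ : Fin d → ℝ) (μ : Fin d) : ‖wc n k θ μ‖ ≤ 1 := by
  unfold wc
  rw [norm_mul]
  exact mul_le_one₀ (norm_uSym_le_one n hn k θ) (norm_nonneg _) (norm_vSym_le_one n hn k θ μ)

/-- `S^μ(θ) ≥ 0` on the non-resonant set. [folklore] -/
theorem ScB_nonneg {m2 : ℝ} (hm2 : 0 ≤ m2) (μ : Fin d) {θ : Fin d → ℝ} (hθ : 0 < dispersion θ) :
    0 ≤ ScB n m2 μ θ :=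
  Finset.sum_nonneg fun k _ => div_nonneg (sq_nonneg _) (sig_pos n hm2 k hθ).le

/-- **`A^μ(·; x)` is continuous on the non-resonant set.** [folklore] -/
theorem continuousOn_AcB {m2 : ℝ} (hm2 : 0 ≤ m2) (μ : Fin d) (x : Fin d → ℕ) :
    ContinuousOn (fun θ => AcB n m2 μ x θ) (nonRes d) := by
  unfold AcB
  refine continuousOn_finsetSum _ fun k _ => ?_
  refine ContinuousOn.mul (Complex.continuous_conj.comp_continuousOn (continuous_phc n k x).continuousOn) ?_
  refine ContinuousOn.div (continuous_wc n k μ).continuousOn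
    (Complex.continuous_ofReal.comp_continuousOn (continuous_sig n m2 k).continuousOn) fun θ hθ => ?_
  exact_mod_cast (sig_pos n hm2 k hθ).ne'

/-- `S^μ` is continuous on the non-resonant set. [folklore] -/
theorem continuousOn_ScB {m2 : ℝ} (hm2 : 0 ≤ m2) (μ : Fin d) :
    ContinuousOn (fun θ => ScB n m2 μ θ) (nonRes d) := by
  unfold ScB
  refine continuousOn_finsetSum _ fun k _ => ?_
  exact ContinuousOn.div (((continuous_wc n k μ).norm).pow 2).continuousOn (continuous_sig n m2 k).continuousOn
    fun θ hθ => (sig_pos n hm2 k hθ).ne'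

/-- `κ^μ` is continuous on the non-resonant set (`a > 0`). [folklore] -/
theorem continuousOn_kcB {a m2 : ℝ} (ha : 0 < a) (hm2 : 0 ≤ m2) (μ : Fin d) :
    ContinuousOn (fun θ => kcB n a m2 μ θ) (nonRes d) := by
  unfold kcB
  refine ContinuousOn.div continuousOn_const
    (continuousOn_const.add (continuousOn_const.mul (continuousOn_ScB n hm2 μ))) fun θ hθ => ?_
  have := ScB_nonneg n hm2 μ (θ := θ) hθ
  positivity

/-- **THE SYMBOL `F^μ(·; x, x′)` IS CONTINUOUS ON THE NON-RESONANT SET** (`a > 0`, `m² ≥ 0`). [folklore] -/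
theorem continuousOn_FcB {a m2 : ℝ} (ha : 0 < a) (hm2 : 0 ≤ m2) (μ : Fin d) (x x' : Fin d → ℕ) :
    ContinuousOn (FcB n a m2 μ x x') (nonRes d) := by
  unfold FcB
  refine ContinuousOn.mul (ContinuousOn.mul ?_ (continuousOn_AcB n hm2 μ x)) ?_
  · exact Complex.continuous_ofReal.comp_continuousOn (continuousOn_kcB n ha hm2 μ)
  · exact Complex.continuous_conj.comp_continuousOn (continuousOn_AcB n hm2 μ x')

/-- … in particular on the punctured zone. [folklore] -/
theorem continuousOn_FcB_brillouin {a m2 : ℝ} (ha : 0 < a) (hm2 : 0 ≤ m2) (μ : Fin d) (x x' : Fin d → ℕ) :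
    ContinuousOn (FcB n a m2 μ x x') (brillouin d \ {0}) :=
  (continuousOn_FcB n ha hm2 μ x x').mono (brillouin_diff_subset_nonRes (d := d))

/-! ## §4 The majorant `‖F^μ(θ)‖ ≤ C₀ᵇ + (π²/4)/ε(θ)` on the non-resonant set — by DENSITY from the torus bound
`WoodburyCovariant.fibre_termW_le` (admissibility of the bond weight: `admissible_bondAvg`) -/

/-- the `θ`-free part of the fibre bound of `WoodburyCovariant.fibre_termW_le` (one factor `π²/4` more than the site
model's `WoodburySymbol.C0`, from (W2)'s exponent `d + 1`). [folklore] -/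
def C0B (d : ℕ) (m2 : ℝ) : ℝ := 2 * aliasC d ^ 2 * ((π ^ 2 / 4) ^ (d + 1) * (d * π ^ 2 + m2))

omit [NeZero n] in
/-- `C₀ᵇ ≥ 0` for `m² ≥ 0`. [folklore] -/
theorem C0B_nonneg {m2 : ℝ} (hm2 : 0 ≤ m2) : 0 ≤ C0B d m2 := by
  unfold C0B
  have := aliasC_nonneg d
  positivity

/-- THE TORUS BOUND AT THE APPROXIMANT: `‖F^μ(θ_m; x, x′)‖ ≤ C₀ᵇ + (π²/4)/ε(θ_m)` whenever `θ_m` is non-resonant and the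
torus of period `n·m` holds `x, x′`. [folklore] -/
theorem norm_FcB_thApprox_le (hd : 0 < d) (hn : 1 ≤ n) {a m2 : ℝ} (ha : 0 < a) (hm2 : 0 ≤ m2) (μ : Fin d)
    (x x' : Fin d → ℕ) {θ : Fin d → ℝ} {m : ℕ} [NeZero m] (hx : ∀ ν, x ν < n * m) (hx' : ∀ ν, x' ν < n * m)
    (hres : thApprox m θ ∈ nonRes d) :
    ‖FcB n a m2 μ x x' (thApprox m θ)‖ ≤ C0B d m2 + (π ^ 2 / 4) / dispersion (thApprox m θ) := by
  obtain ⟨w, hw⟩ := sOf_vApprox (d := d) m θ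
  have hq := vApprox_class_ne_zero (d := d) m hres
  set q : Tor (cubic d m) := fun ν => ((vApprox m θ ν : ℤ) : ZMod m) with hq_def
  set xm : Tor (fine n (cubic d m)) := fun ν => ((x ν : ℕ) : ZMod (fine n (cubic d m) ν)) with hxm
  set xm' : Tor (fine n (cubic d m)) := fun ν => ((x' ν : ℕ) : ZMod (fine n (cubic d m) ν)) with hxm'
  have hvx : (fun ν => (xm ν).val) = x := val_natCast_fine n hx
  have hvx' : (fun ν => (xm' ν).val) = x' := val_natCast_fine n hx'
  have hid : (kapW n (cubic d m) (wt n (cubic d m) (bondAvg n (cubic d m) μ)) a ((n : ℝ) ^ 2) m2 q : ℂ)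
        * fampW n (cubic d m) (wt n (cubic d m) (bondAvg n (cubic d m) μ)) m2 q xm
        * conj (fampW n (cubic d m) (wt n (cubic d m) (bondAvg n (cubic d m) μ)) m2 q xm')
      = FcB n a m2 μ x x' (thApprox m θ) := by
    rw [fibreTermW_eq_FcB, hvx, hvx', hw, FcB_periodic]
  have hB := fibre_termW_le n (cubic d m) (admissible_bondAvg n (cubic d m) hn μ) hd hn ha hm2 hq xm xm'
  rw [hid, lapSym_z] at hB
  have hεeq : dispersion (sOf (cubic d m) q) = dispersion (thApprox m θ) := by
    rw [hw, dispersion_add_int_mul]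
  have hεpos : 0 < dispersion (thApprox m θ) := hres
  have hD := dispersion_le_DeltaXir n hn hm2 (fun ν => abs_sOf_le (cubic d m) q ν)
  rw [hεeq] at hD
  have hDpos : 0 < DeltaXir n m2 (sOf (cubic d m) q) := lt_of_lt_of_le (by positivity) hD
  have h2 : 2 / DeltaXir n m2 (sOf (cubic d m) q) ≤ (π ^ 2 / 4) / dispersion (thApprox m θ) := by
    rw [div_le_div_iff₀ hDpos hεpos]
    have := mul_le_mul_of_nonneg_left hD (by positivity : (0 : ℝ) ≤ π ^ 2 / 4)
    calc 2 * dispersion (thApprox m θ) = π ^ 2 / 4 * (8 / π ^ 2 * dispersion (thApprox m θ)) := by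
          field_simp
          ring
      _ ≤ π ^ 2 / 4 * DeltaXir n m2 (sOf (cubic d m) q) := this
  calc ‖FcB n a m2 μ x x' (thApprox m θ)‖
      ≤ 2 / DeltaXir n m2 (sOf (cubic d m) q) + 2 * aliasC d ^ 2 * ((π ^ 2 / 4) ^ (d + 1) * (d * π ^ 2 + m2)) := hB
    _ ≤ (π ^ 2 / 4) / dispersion (thApprox m θ) + C0B d m2 := add_le_add h2 le_rfl
    _ = C0B d m2 + (π ^ 2 / 4) / dispersion (thApprox m θ) := add_comm _ _

/-- **THE MAJORANT ON THE NON-RESONANT SET**: `‖F^μ(θ; x, x′)‖ ≤ C₀ᵇ + (π²/4)/ε(θ)` for every `θ ∉ (2πℤ)^d`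
(`d ≥ 1`, `n ≥ 1`, `a > 0`, `m² ≥ 0`) — by DENSITY. [folklore] -/
theorem norm_FcB_le (hd : 0 < d) (hn : 1 ≤ n) {a m2 : ℝ} (ha : 0 < a) (hm2 : 0 ≤ m2) (μ : Fin d) (x x' : Fin d → ℕ)
    {θ : Fin d → ℝ} (hθ : θ ∈ nonRes d) :
    ‖FcB n a m2 μ x x' θ‖ ≤ C0B d m2 + (π ^ 2 / 4) / dispersion θ := by
  have hT := tendsto_thApprox (d := d) θ
  have hcont : ContinuousAt (FcB n a m2 μ x x') θ :=
    (continuousOn_FcB n ha hm2 μ x x').continuousAt ((isOpen_nonRes d).mem_nhds hθ)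
  have hg : Tendsto (fun m : ℕ => ‖FcB n a m2 μ x x' (thApprox m θ)‖) atTop (𝓝 ‖FcB n a m2 μ x x' θ‖) :=
    (hcont.tendsto.comp hT).norm
  have hεc : ContinuousAt (dispersion (d := d)) θ := (continuous_dispersion d).continuousAt
  have hθ0 : dispersion θ ≠ 0 := ne_of_gt hθ
  have hh : Tendsto (fun m : ℕ => C0B d m2 + (π ^ 2 / 4) / dispersion (thApprox m θ)) atTop
      (𝓝 (C0B d m2 + (π ^ 2 / 4) / dispersion θ)) :=
    tendsto_const_nhds.add (tendsto_const_nhds.div (hεc.tendsto.comp hT) hθ0)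
  have hres : ∀ᶠ m : ℕ in atTop, thApprox m θ ∈ nonRes d := hT.eventually ((isOpen_nonRes d).mem_nhds hθ)
  set m₀ : ℕ := univ.sup x + univ.sup x' + 1 with hm₀
  have hev : ∀ᶠ m : ℕ in atTop,
      ‖FcB n a m2 μ x x' (thApprox m θ)‖ ≤ C0B d m2 + (π ^ 2 / 4) / dispersion (thApprox m θ) := by
    filter_upwards [hres, eventually_ge_atTop m₀] with m hm hmm₀
    haveI : NeZero m := ⟨by omega⟩
    have hnm : m ≤ n * m := Nat.le_mul_of_pos_left m (by omega)
    have hx : ∀ ν, x ν < n * m := fun ν => by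
      have h1 : x ν ≤ univ.sup x := Finset.le_sup (mem_univ ν)
      omega
    have hx' : ∀ ν, x' ν < n * m := fun ν => by
      have h1 : x' ν ≤ univ.sup x' := Finset.le_sup (mem_univ ν)
      omega
    exact norm_FcB_thApprox_le n hd hn ha hm2 μ x x' hx hx' hm
  exact le_of_tendsto_of_tendsto hg hh hev

/-- … in particular on the punctured zone (the hypothesis shape of `PuncturedRiemannSum`). [folklore] -/
theorem norm_FcB_le_of_mem_brillouin (hd : 0 < d) (hn : 1 ≤ n) {a m2 : ℝ} (ha : 0 < a) (hm2 : 0 ≤ m2) (μ : Fin d)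
    (x x' : Fin d → ℕ) (θ : Fin d → ℝ) (hθ : θ ∈ brillouin d) (hθ0 : θ ≠ 0) :
    ‖FcB n a m2 μ x x' θ‖ ≤ C0B d m2 + (π ^ 2 / 4) / dispersion θ :=
  norm_FcB_le n hd hn ha hm2 μ x x' (brillouin_diff_subset_nonRes (d := d) ⟨hθ, hθ0⟩)

/-! ## §5 The infinite-volume limit of the bond Woodbury kernel along the cubic tori `T ↗ ℤ^d` -/

/-- **ON A CUBIC TORUS `N^d R⊥_w` IS A PUNCTURED MOMENTUM AVERAGE OF THE SYMBOL**:
`N^d R⊥_w(x,x′) = m^{-d} Σ_{k ≠ 0} F^μ(2πk/m; x, x′)`. [folklore] -/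
theorem RperpW_cubic_eq (m : ℕ) [NeZero m] (a m2 : ℝ) (μ : Fin d) (x x' : Tor (fine n (cubic d m))) :
    ((n : ℂ) ^ d) * RperpW n (cubic d m) (wt n (cubic d m) (bondAvg n (cubic d m) μ)) a m2 x x' =
      (((m ^ d : ℕ) : ℝ)⁻¹) • ∑ k ∈ (univ : Finset (TorusSite d m)).erase 0,
        FcB n a m2 μ (fun ν => (x ν).val) (fun ν => (x' ν).val) (latticeMomentum m k) := by
  rw [RperpW_eq_sum_FcB, card_tor_fine_cubic]
  have hsum : ∑ q ∈ (univ : Finset (Tor (cubic d m))).erase 0,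
        FcB n a m2 μ (fun ν => (x ν).val) (fun ν => (x' ν).val) (sOf (cubic d m) q)
      = ∑ k ∈ (univ : Finset (TorusSite d m)).erase 0,
        FcB n a m2 μ (fun ν => (x ν).val) (fun ν => (x' ν).val) (latticeMomentum m k) := by
    refine Finset.sum_congr rfl fun q _ => ?_
    obtain ⟨w, hw⟩ := sOf_cubic_congr (d := d) m q
    rw [hw, FcB_periodic]
  rw [hsum, Complex.real_smul, ← mul_assoc]
  congr 1
  have hn : (n : ℂ) ≠ 0 := by exact_mod_cast NeZero.ne n
  have hm : (m : ℂ) ≠ 0 := by exact_mod_cast NeZero.ne m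
  push_cast
  rw [mul_pow, mul_inv, ← mul_assoc, mul_inv_cancel₀ (pow_ne_zero d hn), one_mul]

/-- **THE INFINITE-VOLUME LIMIT OF THE BOND WOODBURY KERNEL ALONG THE CUBIC TORI** (`d ≥ 3`, `n ≥ 1`, `a > 0`,
`m² ≥ 0`; even coarse periods `m → ∞`, fixed integer points `x, x′`):
`‖N^d R⊥_{w; N,(m,…,m)}(x̂, x̂′) − (2π)^{-d} ∫_{[-π,π]^d} F^μ(θ; x, x′) dθ‖ ≤ ε` for all even `m ≥ m₀(ε, x, x′)`. This is the
`T^{(j+1)} ↗ ℤ^d` step of B12 p. 264 for the bond-block Woodbury part of the one-step fluctuation covariance. [folklore] -/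
theorem RperpW_tendsto_infiniteVolume (hd : 3 ≤ d) (hn : 1 ≤ n) {a m2 : ℝ} (ha : 0 < a) (hm2 : 0 ≤ m2) (μ : Fin d)
    (x x' : Fin d → ℕ) {ε : ℝ} (hε : 0 < ε) :
    ∃ m₀ : ℕ, ∀ (m : ℕ) [NeZero m], Even m → m₀ ≤ m →
      ‖((n : ℂ) ^ d) * RperpW n (cubic d m) (wt n (cubic d m) (bondAvg n (cubic d m) μ)) a m2 (WoodburySymbol.emb n m x) (WoodburySymbol.emb n m x')
          - (((2 * π) ^ d)⁻¹ : ℝ) • ∫ θ in brillouin d, FcB n a m2 μ x x' θ‖ ≤ ε := by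
  have hd0 : 0 < d := by omega
  obtain ⟨L₁, hL₁⟩ := momentumAverage_singular_approx (E := ℂ) hd (C0B_nonneg (d := d) hm2)
    (by positivity : (0 : ℝ) ≤ π ^ 2 / 4) (continuousOn_FcB_brillouin n ha hm2 μ x x')
    (fun θ hθ hθ0 => norm_FcB_le_of_mem_brillouin n hd0 hn ha hm2 μ x x' θ hθ hθ0) (FcB_periodic n a m2 μ x x') hε
  refine ⟨max L₁ (univ.sup x + univ.sup x' + 1), fun m _ hev hm => ?_⟩
  have hm₁ : L₁ ≤ m := le_trans (le_max_left _ _) hm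
  have hm₂ : univ.sup x + univ.sup x' + 1 ≤ m := le_trans (le_max_right _ _) hm
  have hnm : m ≤ n * m := Nat.le_mul_of_pos_left m (by omega)
  have hx : ∀ ν, x ν < n * m := fun ν => by
    have h1 : x ν ≤ univ.sup x := Finset.le_sup (mem_univ ν)
    omega
  have hx' : ∀ ν, x' ν < n * m := fun ν => by
    have h1 : x' ν ≤ univ.sup x' := Finset.le_sup (mem_univ ν)
    omega
  unfold WoodburySymbol.emb
  rw [RperpW_cubic_eq, val_natCast_fine n hx, val_natCast_fine n hx']
  exact hL₁ m hev hm₁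

/-! ## §6 The limit kernel `R⊥_{w,∞}` on `ℕ^d × ℕ^d`, its lattice differences, and the transfer of EVERY volume-uniform
bound of `WoodburyCovariant` (flat, differenced, Hermitian) to it -/

/-- **THE INFINITE-VOLUME BOND WOODBURY KERNEL** `R⊥_{w,∞}(x, x′) := N^{-d}·(2π)^{-d}∫_{[-π,π]^d} F^μ(θ; x, x′) dθ` on
integer points. [folklore] -/
def RperpBLim (a m2 : ℝ) (μ : Fin d) (x x' : Fin d → ℕ) : ℂ :=
  ((n : ℂ) ^ d)⁻¹ * ((((2 * π) ^ d)⁻¹ : ℝ) • ∫ θ in brillouin d, FcB n a m2 μ x x' θ)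

/-- `∇_ρ^x R⊥_{w,∞}` (literal difference). [folklore] -/
def dRperpBLim (a m2 : ℝ) (μ : Fin d) (ρ : Fin d) (x x' : Fin d → ℕ) : ℂ :=
  RperpBLim n a m2 μ (bump ρ x) x' - RperpBLim n a m2 μ x x'

/-- `∇′_ρ^{x′} R⊥_{w,∞}`. [folklore] -/
def dRperpBLim' (a m2 : ℝ) (μ : Fin d) (ρ : Fin d) (x x' : Fin d → ℕ) : ℂ :=
  RperpBLim n a m2 μ x (bump ρ x') - RperpBLim n a m2 μ x x'

/-- `∇_ρ^x ∇_{ρ′}^{x′} R⊥_{w,∞}`. [folklore] -/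
def ddRperpBLim (a m2 : ℝ) (μ : Fin d) (ρ ρ' : Fin d) (x x' : Fin d → ℕ) : ℂ :=
  RperpBLim n a m2 μ (bump ρ x) (bump ρ' x') - RperpBLim n a m2 μ (bump ρ x) x'
    - RperpBLim n a m2 μ x (bump ρ' x') + RperpBLim n a m2 μ x x'

/-- **`R⊥_w → R⊥_{w,∞}` ENTRYWISE ALONG THE EVEN CUBIC TORI** (`d ≥ 3`). [folklore] -/
theorem RperpW_tendsto_RperpBLim (hd : 3 ≤ d) (hn : 1 ≤ n) {a m2 : ℝ} (ha : 0 < a) (hm2 : 0 ≤ m2) (μ : Fin d)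
    (x x' : Fin d → ℕ) {ε : ℝ} (hε : 0 < ε) :
    ∃ m₀ : ℕ, ∀ (m : ℕ) [NeZero m], Even m → m₀ ≤ m →
      ‖RperpW n (cubic d m) (wt n (cubic d m) (bondAvg n (cubic d m) μ)) a m2 (WoodburySymbol.emb n m x) (WoodburySymbol.emb n m x')
          - RperpBLim n a m2 μ x x'‖ ≤ ε := by
  have hn0 : (n : ℂ) ≠ 0 := by exact_mod_cast NeZero.ne n
  have hnC : ((n : ℂ) ^ d) ≠ 0 := pow_ne_zero d hn0
  have hnR : (0 : ℝ) < (n : ℝ) := by exact_mod_cast (show 0 < n by omega)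
  obtain ⟨m₀, hm₀⟩ := RperpW_tendsto_infiniteVolume n hd hn ha hm2 μ x x' (ε := ε * (n : ℝ) ^ d) (by positivity)
  refine ⟨m₀, fun m _ hev hm => ?_⟩
  have h := hm₀ m hev hm
  set R := RperpW n (cubic d m) (wt n (cubic d m) (bondAvg n (cubic d m) μ)) a m2 (WoodburySymbol.emb n m x) (WoodburySymbol.emb n m x') with hR
  have key : R - RperpBLim n a m2 μ x x'
      = ((n : ℂ) ^ d)⁻¹ * (((n : ℂ) ^ d) * R - ((((2 * π) ^ d)⁻¹ : ℝ) • ∫ θ in brillouin d, FcB n a m2 μ x x' θ)) := by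
    unfold RperpBLim
    rw [mul_sub, ← mul_assoc, inv_mul_cancel₀ hnC, one_mul]
  rw [key, norm_mul, norm_inv, norm_pow, Complex.norm_natCast]
  calc ((n : ℝ) ^ d)⁻¹ * ‖((n : ℂ) ^ d) * R - ((((2 * π) ^ d)⁻¹ : ℝ) • ∫ θ in brillouin d, FcB n a m2 μ x x' θ)‖
      ≤ ((n : ℝ) ^ d)⁻¹ * (ε * (n : ℝ) ^ d) := by gcongr
    _ = ε := by field_simp

/-- the differenced kernels at embedded points are differences of `R⊥_w` at embedded bumped points. [folklore] -/
theorem dRperpW_emb (m : ℕ) [NeZero m] (a m2 : ℝ) (μ ρ : Fin d) (x x' : Fin d → ℕ) :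
    dRperpW n (cubic d m) (wt n (cubic d m) (bondAvg n (cubic d m) μ)) a m2 ρ (WoodburySymbol.emb n m x) (WoodburySymbol.emb n m x')
      = RperpW n (cubic d m) (wt n (cubic d m) (bondAvg n (cubic d m) μ)) a m2 (WoodburySymbol.emb n m (bump ρ x)) (WoodburySymbol.emb n m x')
        - RperpW n (cubic d m) (wt n (cubic d m) (bondAvg n (cubic d m) μ)) a m2 (WoodburySymbol.emb n m x) (WoodburySymbol.emb n m x') := by
  unfold dRperpW; rw [emb_bump]

/-- see `dRperpW_emb`. [folklore] -/
theorem dRperpW'_emb (m : ℕ) [NeZero m] (a m2 : ℝ) (μ ρ : Fin d) (x x' : Fin d → ℕ) :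
    dRperpW' n (cubic d m) (wt n (cubic d m) (bondAvg n (cubic d m) μ)) a m2 ρ (WoodburySymbol.emb n m x) (WoodburySymbol.emb n m x')
      = RperpW n (cubic d m) (wt n (cubic d m) (bondAvg n (cubic d m) μ)) a m2 (WoodburySymbol.emb n m x) (WoodburySymbol.emb n m (bump ρ x'))
        - RperpW n (cubic d m) (wt n (cubic d m) (bondAvg n (cubic d m) μ)) a m2 (WoodburySymbol.emb n m x) (WoodburySymbol.emb n m x') := by
  unfold dRperpW'; rw [emb_bump]

/-- see `dRperpW_emb`. [folklore] -/
theorem ddRperpW_emb (m : ℕ) [NeZero m] (a m2 : ℝ) (μ ρ ρ' : Fin d) (x x' : Fin d → ℕ) :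
    ddRperpW n (cubic d m) (wt n (cubic d m) (bondAvg n (cubic d m) μ)) a m2 ρ ρ' (WoodburySymbol.emb n m x) (WoodburySymbol.emb n m x')
      = RperpW n (cubic d m) (wt n (cubic d m) (bondAvg n (cubic d m) μ)) a m2 (WoodburySymbol.emb n m (bump ρ x)) (WoodburySymbol.emb n m (bump ρ' x'))
        - RperpW n (cubic d m) (wt n (cubic d m) (bondAvg n (cubic d m) μ)) a m2 (WoodburySymbol.emb n m (bump ρ x)) (WoodburySymbol.emb n m x')
        - RperpW n (cubic d m) (wt n (cubic d m) (bondAvg n (cubic d m) μ)) a m2 (WoodburySymbol.emb n m x) (WoodburySymbol.emb n m (bump ρ' x'))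
        + RperpW n (cubic d m) (wt n (cubic d m) (bondAvg n (cubic d m) μ)) a m2 (WoodburySymbol.emb n m x) (WoodburySymbol.emb n m x') := by
  unfold ddRperpW; rw [emb_bump, emb_bump]

/-- `∇R⊥_w → ∇R⊥_{w,∞}` along the even cubic tori (`d ≥ 3`). [folklore] -/
theorem dRperpW_tendsto (hd : 3 ≤ d) (hn : 1 ≤ n) {a m2 : ℝ} (ha : 0 < a) (hm2 : 0 ≤ m2) (μ ρ : Fin d)
    (x x' : Fin d → ℕ) {ε : ℝ} (hε : 0 < ε) :
    ∃ m₀ : ℕ, ∀ (m : ℕ) [NeZero m], Even m → m₀ ≤ m →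
      ‖dRperpW n (cubic d m) (wt n (cubic d m) (bondAvg n (cubic d m) μ)) a m2 ρ (WoodburySymbol.emb n m x) (WoodburySymbol.emb n m x')
          - dRperpBLim n a m2 μ ρ x x'‖ ≤ ε := by
  obtain ⟨m₁, h₁⟩ := RperpW_tendsto_RperpBLim n hd hn ha hm2 μ (bump ρ x) x' (half_pos hε)
  obtain ⟨m₂, h₂⟩ := RperpW_tendsto_RperpBLim n hd hn ha hm2 μ x x' (half_pos hε)
  refine ⟨max m₁ m₂, fun m _ hev hm => ?_⟩
  rw [dRperpW_emb]
  unfold dRperpBLim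
  have e1 := h₁ m hev (le_of_max_le_left hm)
  have e2 := h₂ m hev (le_of_max_le_right hm)
  set A := RperpW n (cubic d m) (wt n (cubic d m) (bondAvg n (cubic d m) μ)) a m2 (WoodburySymbol.emb n m (bump ρ x)) (WoodburySymbol.emb n m x')
  set B := RperpW n (cubic d m) (wt n (cubic d m) (bondAvg n (cubic d m) μ)) a m2 (WoodburySymbol.emb n m x) (WoodburySymbol.emb n m x')
  set A' := RperpBLim n a m2 μ (bump ρ x) x'
  set B' := RperpBLim n a m2 μ x x'
  calc ‖A - B - (A' - B')‖ = ‖(A - A') - (B - B')‖ := by ring_nf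
    _ ≤ ‖A - A'‖ + ‖B - B'‖ := norm_sub_le _ _
    _ ≤ ε / 2 + ε / 2 := add_le_add e1 e2
    _ = ε := by ring

/-- `∇′R⊥_w → ∇′R⊥_{w,∞}` along the even cubic tori (`d ≥ 3`). [folklore] -/
theorem dRperpW'_tendsto (hd : 3 ≤ d) (hn : 1 ≤ n) {a m2 : ℝ} (ha : 0 < a) (hm2 : 0 ≤ m2) (μ ρ : Fin d)
    (x x' : Fin d → ℕ) {ε : ℝ} (hε : 0 < ε) :
    ∃ m₀ : ℕ, ∀ (m : ℕ) [NeZero m], Even m → m₀ ≤ m →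
      ‖dRperpW' n (cubic d m) (wt n (cubic d m) (bondAvg n (cubic d m) μ)) a m2 ρ (WoodburySymbol.emb n m x) (WoodburySymbol.emb n m x')
          - dRperpBLim' n a m2 μ ρ x x'‖ ≤ ε := by
  obtain ⟨m₁, h₁⟩ := RperpW_tendsto_RperpBLim n hd hn ha hm2 μ x (bump ρ x') (half_pos hε)
  obtain ⟨m₂, h₂⟩ := RperpW_tendsto_RperpBLim n hd hn ha hm2 μ x x' (half_pos hε)
  refine ⟨max m₁ m₂, fun m _ hev hm => ?_⟩
  rw [dRperpW'_emb]
  unfold dRperpBLim'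
  have e1 := h₁ m hev (le_of_max_le_left hm)
  have e2 := h₂ m hev (le_of_max_le_right hm)
  set A := RperpW n (cubic d m) (wt n (cubic d m) (bondAvg n (cubic d m) μ)) a m2 (WoodburySymbol.emb n m x) (WoodburySymbol.emb n m (bump ρ x'))
  set B := RperpW n (cubic d m) (wt n (cubic d m) (bondAvg n (cubic d m) μ)) a m2 (WoodburySymbol.emb n m x) (WoodburySymbol.emb n m x')
  set A' := RperpBLim n a m2 μ x (bump ρ x')
  set B' := RperpBLim n a m2 μ x x'
  calc ‖A - B - (A' - B')‖ = ‖(A - A') - (B - B')‖ := by ring_nf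
    _ ≤ ‖A - A'‖ + ‖B - B'‖ := norm_sub_le _ _
    _ ≤ ε / 2 + ε / 2 := add_le_add e1 e2
    _ = ε := by ring

/-- `∇∇′R⊥_w → ∇∇′R⊥_{w,∞}` along the even cubic tori (`d ≥ 3`). [folklore] -/
theorem ddRperpW_tendsto (hd : 3 ≤ d) (hn : 1 ≤ n) {a m2 : ℝ} (ha : 0 < a) (hm2 : 0 ≤ m2) (μ ρ ρ' : Fin d)
    (x x' : Fin d → ℕ) {ε : ℝ} (hε : 0 < ε) :
    ∃ m₀ : ℕ, ∀ (m : ℕ) [NeZero m], Even m → m₀ ≤ m →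
      ‖ddRperpW n (cubic d m) (wt n (cubic d m) (bondAvg n (cubic d m) μ)) a m2 ρ ρ' (WoodburySymbol.emb n m x) (WoodburySymbol.emb n m x')
          - ddRperpBLim n a m2 μ ρ ρ' x x'‖ ≤ ε := by
  have hε4 : 0 < ε / 4 := by positivity
  obtain ⟨m₁, h₁⟩ := RperpW_tendsto_RperpBLim n hd hn ha hm2 μ (bump ρ x) (bump ρ' x') hε4
  obtain ⟨m₂, h₂⟩ := RperpW_tendsto_RperpBLim n hd hn ha hm2 μ (bump ρ x) x' hε4
  obtain ⟨m₃, h₃⟩ := RperpW_tendsto_RperpBLim n hd hn ha hm2 μ x (bump ρ' x') hε4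
  obtain ⟨m₄, h₄⟩ := RperpW_tendsto_RperpBLim n hd hn ha hm2 μ x x' hε4
  refine ⟨max (max m₁ m₂) (max m₃ m₄), fun m _ hev hm => ?_⟩
  rw [ddRperpW_emb]
  unfold ddRperpBLim
  have hm12 := le_of_max_le_left hm
  have hm34 := le_of_max_le_right hm
  have e1 := h₁ m hev (le_of_max_le_left hm12)
  have e2 := h₂ m hev (le_of_max_le_right hm12)
  have e3 := h₃ m hev (le_of_max_le_left hm34)
  have e4 := h₄ m hev (le_of_max_le_right hm34)
  set A := RperpW n (cubic d m) (wt n (cubic d m) (bondAvg n (cubic d m) μ)) a m2 (WoodburySymbol.emb n m (bump ρ x))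
    (WoodburySymbol.emb n m (bump ρ' x'))
  set B := RperpW n (cubic d m) (wt n (cubic d m) (bondAvg n (cubic d m) μ)) a m2 (WoodburySymbol.emb n m (bump ρ x)) (WoodburySymbol.emb n m x')
  set C := RperpW n (cubic d m) (wt n (cubic d m) (bondAvg n (cubic d m) μ)) a m2 (WoodburySymbol.emb n m x) (WoodburySymbol.emb n m (bump ρ' x'))
  set D := RperpW n (cubic d m) (wt n (cubic d m) (bondAvg n (cubic d m) μ)) a m2 (WoodburySymbol.emb n m x) (WoodburySymbol.emb n m x')
  set A' := RperpBLim n a m2 μ (bump ρ x) (bump ρ' x')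
  set B' := RperpBLim n a m2 μ (bump ρ x) x'
  set C' := RperpBLim n a m2 μ x (bump ρ' x')
  set D' := RperpBLim n a m2 μ x x'
  calc ‖A - B - C + D - (A' - B' - C' + D')‖ = ‖((A - A') - (B - B')) - ((C - C') - (D - D'))‖ := by ring_nf
    _ ≤ ‖(A - A') - (B - B')‖ + ‖(C - C') - (D - D')‖ := norm_sub_le _ _
    _ ≤ (‖A - A'‖ + ‖B - B'‖) + (‖C - C'‖ + ‖D - D'‖) := add_le_add (norm_sub_le _ _) (norm_sub_le _ _)
    _ ≤ (ε / 4 + ε / 4) + (ε / 4 + ε / 4) := by gcongr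
    _ = ε := by ring

/-- **HERMITIAN SYMMETRY OF THE LIMIT KERNEL** (`d ≥ 3`): `R⊥_{w,∞}(x′, x) = conj R⊥_{w,∞}(x, x′)` — inherited from
`WoodburyCovariant.RperpW_swap` through the limit. [folklore] -/
theorem RperpBLim_swap (hd : 3 ≤ d) (hn : 1 ≤ n) {a m2 : ℝ} (ha : 0 < a) (hm2 : 0 ≤ m2) (μ : Fin d)
    (x x' : Fin d → ℕ) : RperpBLim n a m2 μ x' x = conj (RperpBLim n a m2 μ x x') := by
  refine eq_of_forall_dist_le fun ε hε => ?_
  obtain ⟨m₁, h₁⟩ := RperpW_tendsto_RperpBLim n hd hn ha hm2 μ x' x (half_pos hε)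
  obtain ⟨m₂, h₂⟩ := RperpW_tendsto_RperpBLim n hd hn ha hm2 μ x x' (half_pos hε)
  set m : ℕ := 2 * (max m₁ m₂ + 1) with hm_def
  haveI : NeZero m := ⟨by omega⟩
  have hev : Even m := ⟨max m₁ m₂ + 1, by omega⟩
  have e1 := h₁ m hev (by omega)
  have e2 := h₂ m hev (by omega)
  have hsw := RperpW_swap n (cubic d m) (wt n (cubic d m) (bondAvg n (cubic d m) μ)) a m2 (WoodburySymbol.emb n m x) (WoodburySymbol.emb n m x')
  rw [dist_eq_norm]
  set R := RperpW n (cubic d m) (wt n (cubic d m) (bondAvg n (cubic d m) μ)) a m2 (WoodburySymbol.emb n m x) (WoodburySymbol.emb n m x')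
  set L := RperpBLim n a m2 μ x x'
  set L' := RperpBLim n a m2 μ x' x
  have key : L' - conj L
      = -(RperpW n (cubic d m) (wt n (cubic d m) (bondAvg n (cubic d m) μ)) a m2 (WoodburySymbol.emb n m x') (WoodburySymbol.emb n m x) - L')
        + conj (R - L) := by
    rw [hsw, map_sub]; ring
  rw [key]
  calc ‖-(RperpW n (cubic d m) (wt n (cubic d m) (bondAvg n (cubic d m) μ)) a m2 (WoodburySymbol.emb n m x') (WoodburySymbol.emb n m x) - L')
          + conj (R - L)‖
      ≤ ‖-(RperpW n (cubic d m) (wt n (cubic d m) (bondAvg n (cubic d m) μ)) a m2 (WoodburySymbol.emb n m x') (WoodburySymbol.emb n m x) - L')‖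
          + ‖conj (R - L)‖ := norm_add_le _ _
    _ = ‖RperpW n (cubic d m) (wt n (cubic d m) (bondAvg n (cubic d m) μ)) a m2 (WoodburySymbol.emb n m x') (WoodburySymbol.emb n m x) - L'‖
          + ‖R - L‖ := by rw [norm_neg, Complex.norm_conj]
    _ ≤ ε / 2 + ε / 2 := add_le_add e1 e2
    _ = ε := by ring

/-! ### `d = 4`: the volume-uniform bounds of `WoodburyCovariant` pass to the limit kernel -/

/-- **`‖R⊥_{w,∞}(x,x′)‖ ≤ Dᶜ(m²)/N⁴`** (`d = 4`; from `WoodburyCovariant.norm_RperpW_le`). [folklore] -/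
theorem norm_RperpBLim_le (hn : 1 ≤ n) {a m2 : ℝ} (ha : 0 < a) (hm2 : 0 ≤ m2) (μ : Fin 4) (x x' : Fin 4 → ℕ) :
    ‖RperpBLim n a m2 μ x x'‖ ≤ woodburyDc m2 / (n : ℝ) ^ 4 := by
  refine le_of_forall_pos_le_add fun ε hε => ?_
  obtain ⟨m₀, hm₀⟩ := RperpW_tendsto_RperpBLim n (d := 4) (by norm_num) hn ha hm2 μ x x' hε
  obtain ⟨m, hm0, hev, hm⟩ := exists_even_ge m₀
  haveI : NeZero m := ⟨hm0⟩
  exact norm_le_of_near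
    (norm_RperpW_le n m (admissible_bondAvg n (cubic 4 m) hn μ) hn ha hm2 (WoodburySymbol.emb n m x) (WoodburySymbol.emb n m x')) (hm₀ m hev hm)

/-- **`‖∇_ρ R⊥_{w,∞}(x,x′)‖ ≤ D₁ᶜ(m²)/N⁵`** (`d = 4`; from `WoodburyCovariant.norm_dRperpW_le`). [folklore] -/
theorem norm_dRperpBLim_le (hn : 1 ≤ n) {a m2 : ℝ} (ha : 0 < a) (hm2 : 0 ≤ m2) (μ ρ : Fin 4) (x x' : Fin 4 → ℕ) :
    ‖dRperpBLim n a m2 μ ρ x x'‖ ≤ woodburyD1c m2 / (n : ℝ) ^ 5 := by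
  refine le_of_forall_pos_le_add fun ε hε => ?_
  obtain ⟨m₀, hm₀⟩ := dRperpW_tendsto n (d := 4) (by norm_num) hn ha hm2 μ ρ x x' hε
  obtain ⟨m, hm0, hev, hm⟩ := exists_even_ge m₀
  haveI : NeZero m := ⟨hm0⟩
  exact norm_le_of_near
    (norm_dRperpW_le n m (admissible_bondAvg n (cubic 4 m) hn μ) hn ha hm2 ρ (WoodburySymbol.emb n m x) (WoodburySymbol.emb n m x')) (hm₀ m hev hm)

/-- **`‖∇′_ρ R⊥_{w,∞}(x,x′)‖ ≤ D₁ᶜ(m²)/N⁵`** (`d = 4`; from `WoodburyCovariant.norm_dRperpW'_le`). [folklore] -/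
theorem norm_dRperpBLim'_le (hn : 1 ≤ n) {a m2 : ℝ} (ha : 0 < a) (hm2 : 0 ≤ m2) (μ ρ : Fin 4) (x x' : Fin 4 → ℕ) :
    ‖dRperpBLim' n a m2 μ ρ x x'‖ ≤ woodburyD1c m2 / (n : ℝ) ^ 5 := by
  refine le_of_forall_pos_le_add fun ε hε => ?_
  obtain ⟨m₀, hm₀⟩ := dRperpW'_tendsto n (d := 4) (by norm_num) hn ha hm2 μ ρ x x' hε
  obtain ⟨m, hm0, hev, hm⟩ := exists_even_ge m₀
  haveI : NeZero m := ⟨hm0⟩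
  exact norm_le_of_near
    (norm_dRperpW'_le n m (admissible_bondAvg n (cubic 4 m) hn μ) hn ha hm2 ρ (WoodburySymbol.emb n m x) (WoodburySymbol.emb n m x')) (hm₀ m hev hm)

/-- **`‖∇_ρ∇′_{ρ′} R⊥_{w,∞}(x,x′)‖ ≤ D₂ᶜ(m²)/N⁶`** (`d = 4`; from `WoodburyCovariant.norm_ddRperpW_le`). [folklore] -/
theorem norm_ddRperpBLim_le (hn : 1 ≤ n) {a m2 : ℝ} (ha : 0 < a) (hm2 : 0 ≤ m2) (μ ρ ρ' : Fin 4)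
    (x x' : Fin 4 → ℕ) : ‖ddRperpBLim n a m2 μ ρ ρ' x x'‖ ≤ woodburyD2c m2 / (n : ℝ) ^ 6 := by
  refine le_of_forall_pos_le_add fun ε hε => ?_
  obtain ⟨m₀, hm₀⟩ := ddRperpW_tendsto n (d := 4) (by norm_num) hn ha hm2 μ ρ ρ' x x' hε
  obtain ⟨m, hm0, hev, hm⟩ := exists_even_ge m₀
  haveI : NeZero m := ⟨hm0⟩
  exact norm_le_of_near
    (norm_ddRperpW_le n m (admissible_bondAvg n (cubic 4 m) hn μ) hn ha hm2 ρ ρ' (WoodburySymbol.emb n m x) (WoodburySymbol.emb n m x'))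
    (hm₀ m hev hm)

end Literature.MathematicalPhysics.QuantumFieldTheory.Balaban1983to89.Beta.WoodburyBondSymbol
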